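import Summits.QuantumAdvantage.QuantumAdvantage.Theorems.LinnikCubicClassGroupsDegreeOnePrimesEscapeCubicSplittingPrimes
import Summits.QuantumAdvantage.QuantumAdvantage.Theorems.LinnikCubicClassGroupsDegreeOnePrimesEscapeCubicInertPrimeLemmas
import Summits.QuantumAdvantage.QuantumAdvantage.Theorems.LinnikCubicClassGroupsDegreeOnePrimesEscapeClassPNTDHRelativePointed
import Summits.QuantumAdvantage.QuantumAdvantage.Theorems.LinnikCubicClassGroupsDegreeOnePrimesEscapeSexticZeroTransfer
import Summits.QuantumAdvantage.QuantumAdvantage.Theorems.LinnikCubicClassGroupsDegreeOnePrimesEscapeClassPNTDHInputs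
import HarnessLib

/-!
# The least inert prime of a cubic field is `≤ |d_K|^L`, unconditionally (Chebotarev–Linnik for `S₃`)

Topic `Summits/QuantumAdvantage/QuantumAdvantage/Theorems`, cell B2b-1 (linnik-cubic), PART A (gen 7);
helper toward the crux `DegreeOnePrimesEscape` (stmt-QuantumAdvantage-11543) of route
`LinnikCubicClassGroups`.  HONEST FRAMING: the value of this file is a THEOREM (kernel-checked, GRH-free,
Siegel-free, no hypothesis) — NOT summit progress (the route still rests on the hypothesis-type target
`PureCubicClassNumberHard`).

**Theorem** (`exists_inertPrime_le_of_not_isGalois`, `exists_inertPrime_le`).  There is an absolute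
`L > 0` such that every cubic number field `K` has a rational prime `p ≤ |d_K|^{L}` that is INERT in `K`
(`p𝓞_K` is a prime ideal).  For a non-Galois `K` this is the Lagarias–Montgomery–Odlyzko theorem
[LagariasMontgomeryOdlyzko1979] for the class of 3-cycles in `Gal(N/ℚ) ≅ S₃` (`N` the Galois closure),
the first non-abelian Frobenius class in the tree; the exponent `L` is inexplicit, so this is an
INDEPENDENT KERNEL-CHECKED CERTIFICATION of a known theorem by a different route, not a new bound.

Proof (no Artin `L`-functions).  With `k ⊂ N` the quadratic resolvent and `K' ≅ K` in `N`, counting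
splitting types prime by prime gives (`…CubicSplittingTheta.lean`)
`3 Σ_{p ≤ x inert} log p ≥ θ(x) + θ¹_k(x) − θ¹_{K'}(x) − 3 log|d_N|` and
`6 Σ_{p ≤ x inert} log p ≥ 3 θ¹_k(x) − θ¹_N(x) − 6 log|d_N|`.  Uniformly in the Linnik range,
`θ_{K'}(x) ≤ (1+η)x` (`chebyshevThetaIdeal_le_uniform`), and by the class prime number theorem with
relative error for quadratic fields (`thetaClass_relative`, Deuring–Heilbronn) either `θ_k(x) ≥ (1−η)x`
— then the first inequality wins — or `ζ_k` has a real zero `β` near `1` and `θ_k(x) ≈ M = x − x^β/β`.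
If `M ≥ x/3` the first inequality still wins.  If `M < x/3` (the Landau–Siegel regime,
`(1 − β) log x < log 2`), then `β` is a zero of `ζ_N` (`dedekindZeta₁_eq_zero_of_resolvent`) lying in
the Landau–Page window of `N` as soon as `x ≥ |d_K|^{(A+2)/c}`, and the POINTED relative prime number
theorem for `N` (`chebyshevThetaIdeal_relative_at_realZero`) gives `θ_N(x) ≤ (1+η)M` with the SAME `M`;
the second inequality wins since `3(1−η) − (1+η) > 0`, the main term `M ≫ x Q_k^{−2}` (Stark) beating
the junk `O(x^{5/8})` and `log|d_N| ≤ A log|d_K|`.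

Placement (presearch 2026-08-19): the statement is KNOWN in print with explicit exponents — Lagarias–
Montgomery–Odlyzko 1979 (`p ≪ d_N^{c}`), Cho–Kim (sign changes of modular/Maass forms: `α(S₃,[(123)]) =
3/16`, resp. `1/4 − δ`) and P. J. Cho, R. J. Lemke Oliver, A. Zaman, *The least prime with a given cycle
type*, arXiv:2512.24963 (2025, zero-free method, all `S_n`).  What is new here is only the KERNEL-CHECKED
proof, by the classical zero-density/Deuring–Heilbronn route of this cell, with an inexplicit exponent.

References: J. C. Lagarias, H. L. Montgomery, A. M. Odlyzko, Invent. Math. 54 (1979) 271–296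
[LagariasMontgomeryOdlyzko1979]; J. Thorner, A. Zaman, Algebra Number Theory 13 (2019) [ThornerZaman2019];
A. Weiss, J. reine angew. Math. 338 (1983) [Weiss1983].
-/

noncomputable section

open scoped NumberField nonZeroDivisors
open Finset Real Ideal NumberField
open Literature.NumberTheory.NumberFields Literature.NumberTheory.LFunctions
  Literature.NumberTheory.LFunctions.NumberField

namespace Summit.QuantumAdvantage.QuantumAdvantage.Theorems.DegreeOnePrimesEscape

/-! ### The theorem for non-Galois cubic fields -/

set_option maxHeartbeats 1600000 in
/-- **The least inert prime of a non-Galois cubic field, unconditionally** (Chebotarev–Linnik for the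
3-cycles of `S₃`): there is `L > 0` such that every cubic number field `K` that is not Galois over `ℚ`
has a rational prime `p ≤ |d_K|^{L}` with `p𝓞_K` prime. GRH-free, Siegel-free, no hypothesis.
[cite: LagariasMontgomeryOdlyzko1979, Theorem 1.1] [cite: Weiss1983, Theorem 5.2] -/
theorem exists_inertPrime_le_of_not_isGalois :
    ∃ L : ℝ, 0 < L ∧ ∀ (K : Type) [Field K] [NumberField K], Module.finrank ℚ K = 3 →
      ¬ IsGalois ℚ K →
        ∃ p : ℕ, p.Prime ∧ (p : ℝ) ≤ ((NumberField.discr K).natAbs : ℝ) ^ L ∧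
          (Ideal.span {(p : 𝓞 K)}).IsPrime := by
  classical
  -- constants
  obtain ⟨a₃, ha₃, hup3⟩ := chebyshevThetaIdeal_le_uniform 3 (by norm_num) (η := 1 / 20) (by norm_num)
  obtain ⟨x₀, hx₀2, hθQ⟩ := chebyshevTheta_eventually_ge (η := 1 / 20) (by norm_num)
  obtain ⟨a₂, c₂, ha₂, hc₂, hc₂n, hrel2⟩ := thetaClass_relative 2 (by norm_num) (ε := 1 / 20) (by norm_num)
  obtain ⟨a₆, c₆, ha₆, hc₆, hrel6⟩ :=
    chebyshevThetaIdeal_relative_at_realZero 6 (by norm_num) (ε := 1 / 20) (by norm_num)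
  obtain ⟨c₁, hc₁, hc₁1, heff⟩ := Residue.one_sub_realZero_ge_condQn_rpow 2 (by norm_num)
  obtain ⟨A, hclos⟩ := stub_cubicClosure
  have hA0 : (0 : ℝ) ≤ A := Nat.cast_nonneg A
  -- the exponent (requirements (R1)–(R8) of the proof)
  set e : ℝ := (A : ℝ) + 2 with he_def
  have he0 : 0 ≤ e := by positivity
  set B₈ : ℝ := 3 * 10 ^ 8 / c₁ + 2 * 10 ^ 8 with hB₈
  have hB₈0 : (0 : ℝ) ≤ 3 * 10 ^ 8 / c₁ := by positivity
  have hB₈1 : (1 : ℝ) ≤ B₈ := by rw [hB₈]; linarith only [hB₈0]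
  set B₉ : ℝ := 30 * A / c₁ + 1 with hB₉
  have hB₉0 : (0 : ℝ) ≤ 30 * A / c₁ := by positivity
  have hB₉1 : (1 : ℝ) ≤ B₉ := by rw [hB₉]; linarith only [hB₉0]
  set X₀ : ℝ := max x₀ (Real.exp 16) with hX₀
  have hX₀1 : (1 : ℝ) ≤ X₀ := le_trans (by linarith only [hx₀2]) (le_max_left _ _)
  set L : ℝ := max (max (max (4 * a₃) (e * a₂)) (max ((A + 10) * a₆) ((A + 2) / c₆)))
    (max (max (Real.logb 3 X₀) (1 + Real.logb 3 (30 * A + 1)))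
      (max ((8 / 3) * (2 * e + Real.logb 3 B₈)) (2 * e + 1 + Real.logb 3 B₉))) with hL
  have hL1 : 4 * a₃ ≤ L := le_trans (le_trans (le_max_left _ _) (le_max_left _ _)) (le_max_left _ _)
  have hL2 : e * a₂ ≤ L := le_trans (le_trans (le_max_right _ _) (le_max_left _ _)) (le_max_left _ _)
  have hL3 : (A + 10) * a₆ ≤ L := le_trans (le_trans (le_max_left _ _) (le_max_right _ _)) (le_max_left _ _)
  have hL7 : (A + 2) / c₆ ≤ L := le_trans (le_trans (le_max_right _ _) (le_max_right _ _)) (le_max_left _ _)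
  have hL4 : Real.logb 3 X₀ ≤ L :=
    le_trans (le_trans (le_max_left _ _) (le_max_left _ _)) (le_max_right _ _)
  have hL6 : 1 + Real.logb 3 (30 * A + 1) ≤ L :=
    le_trans (le_trans (le_max_right _ _) (le_max_left _ _)) (le_max_right _ _)
  have hL8 : (8 / 3) * (2 * e + Real.logb 3 B₈) ≤ L :=
    le_trans (le_trans (le_max_left _ _) (le_max_right _ _)) (le_max_right _ _)
  have hL9 : 2 * e + 1 + Real.logb 3 B₉ ≤ L :=
    le_trans (le_trans (le_max_right _ _) (le_max_right _ _)) (le_max_right _ _)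
  have hLpos : 0 < L := lt_of_lt_of_le (by linarith only [ha₃]) hL1
  refine ⟨L, hLpos, fun K _ _ h3 hKng => ?_⟩
  -- the closure
  obtain ⟨N, _, _, hGal, h6, hna, ⟨K', ⟨eK⟩⟩, ⟨k, hk⟩, hdN⟩ := hclos K h3 hKng
  haveI := hGal
  have hK' : Module.finrank ℚ K' = 3 := by rw [← eK.toLinearEquiv.finrank_eq, h3]
  have hdisc' : NumberField.discr K' = NumberField.discr K := (NumberField.discr_eq_discr_of_algEquiv K eK).symm
  -- sizes
  set d : ℝ := ((NumberField.discr K).natAbs : ℝ) with hd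
  have hd3 : (3 : ℝ) ≤ d := three_le_natAbs_discr_real K (by rw [h3]; norm_num)
  have hd0 : (0 : ℝ) < d := by linarith only [hd3]
  have hd1 : (1 : ℝ) ≤ d := by linarith only [hd3]
  have hlogd0 : 0 < Real.log d := Real.log_pos (by linarith only [hd3])
  have hlogd : Real.log d ≤ d := (Real.log_le_sub_one_of_pos hd0).trans (by linarith only [])
  set x : ℝ := d ^ L with hx
  have hx0 : 0 < x := Real.rpow_pos_of_pos hd0 L
  have hlogx : Real.log x = L * Real.log d := by rw [hx, Real.log_rpow hd0]
  -- discriminants in the tower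
  have hdkN : ((NumberField.discr k).natAbs : ℝ) ≤ ((NumberField.discr N).natAbs : ℝ) := by
    exact_mod_cast Nat.le_of_dvd (Int.natAbs_pos.mpr (NumberField.discr_ne_zero N))
      (Int.natAbs_dvd_natAbs.mpr (NumberField.discr_dvd_discr k N))
  have hdNK : ((NumberField.discr N).natAbs : ℝ) ≤ d ^ (A : ℝ) := by
    rw [Real.rpow_natCast, hd]; exact_mod_cast hdN
  have hdN1 : (1 : ℝ) ≤ ((NumberField.discr N).natAbs : ℝ) := by
    have h1 := Int.one_le_abs (NumberField.discr_ne_zero N)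
    rw [Int.abs_eq_natAbs] at h1; exact_mod_cast h1
  have hlogN0 : 0 ≤ Real.log ((NumberField.discr N).natAbs : ℝ) := Real.log_nonneg hdN1
  have hlogN : Real.log ((NumberField.discr N).natAbs : ℝ) ≤ A * Real.log d := by
    rw [← Real.log_rpow hd0]; exact Real.log_le_log (by linarith only [hdN1]) hdNK
  have hlogNd : Real.log ((NumberField.discr N).natAbs : ℝ) ≤ A * d :=
    hlogN.trans (mul_le_mul_of_nonneg_left hlogd hA0)
  -- `Q_{K'} ≤ d^4`, `Q_k ≤ d^e`, `Q_N ≤ d^{A+10}`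
  have hQK' : ThornerZaman.condQn K' ≤ d ^ (4 : ℝ) := by
    have := condQn_le_natAbs_discr_rpow K' (by rw [hK']; norm_num)
    rw [hK', hdisc'] at this
    have e4 : (1 : ℝ) + ((3 : ℕ) : ℝ) * Real.log ((3 : ℕ) : ℝ) / Real.log 3 = 4 := by
      have hlog3 : Real.log 3 ≠ 0 := (Real.log_pos (by norm_num)).ne'
      push_cast; field_simp; ring
    rwa [e4] at this
  have hQk : ThornerZaman.condQn k ≤ d ^ e := by
    rw [ThornerZaman.condQn, hk, ← Int.cast_abs, Int.abs_eq_natAbs, Int.cast_natCast, he_def,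
      Real.rpow_add hd0, Real.rpow_two]
    push_cast
    have h4 : (4 : ℝ) ≤ d ^ 2 := by nlinarith only [hd3]
    calc ((NumberField.discr k).natAbs : ℝ) * (2 : ℝ) ^ 2 = ((NumberField.discr k).natAbs : ℝ) * 4 := by
          norm_num
      _ ≤ d ^ (A : ℝ) * d ^ 2 := mul_le_mul (hdkN.trans hdNK) h4 (by norm_num) (by positivity)
  have hQN : ThornerZaman.condQn N ≤ d ^ ((A : ℝ) + 10) := by
    rw [ThornerZaman.condQn, h6, ← Int.cast_abs, Int.abs_eq_natAbs, Int.cast_natCast, Real.rpow_add hd0]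
    push_cast
    have h10 : (6 : ℝ) ^ 6 ≤ d ^ (10 : ℝ) := by
      have h310 : (3 : ℝ) ^ (10 : ℝ) = 59049 := by norm_num
      calc (6 : ℝ) ^ 6 ≤ (3 : ℝ) ^ (10 : ℝ) := by rw [h310]; norm_num
        _ ≤ d ^ (10 : ℝ) := Real.rpow_le_rpow (by norm_num) hd3 (by norm_num)
    exact mul_le_mul hdNK h10 (by positivity) (by positivity)
  have hQK'12 : (12 : ℝ) ≤ ThornerZaman.condQn K' := ThornerZaman.twelve_le_condQn (K := K') (by rw [hK']; norm_num)
  have hQk12 : (12 : ℝ) ≤ ThornerZaman.condQn k := ThornerZaman.twelve_le_condQn (K := k) (by rw [hk]; norm_num)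
  have hQN12 : (12 : ℝ) ≤ ThornerZaman.condQn N := ThornerZaman.twelve_le_condQn (K := N) (by rw [h6]; norm_num)
  -- the requirements at `x = d^L`
  have hpowle : ∀ {s t : ℝ}, s ≤ t → d ^ s ≤ d ^ t := fun hst ↦ Real.rpow_le_rpow_of_exponent_le hd1 hst
  have hR1 : ThornerZaman.condQn K' ^ a₃ ≤ x := by
    calc ThornerZaman.condQn K' ^ a₃ ≤ (d ^ (4 : ℝ)) ^ a₃ :=
          Real.rpow_le_rpow (by linarith only [hQK'12]) hQK' (by linarith only [ha₃])
      _ = d ^ (4 * a₃) := by rw [← Real.rpow_mul hd0.le]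
      _ ≤ x := hpowle hL1
  have hR2 : ThornerZaman.condQn k ^ a₂ ≤ x := by
    calc ThornerZaman.condQn k ^ a₂ ≤ (d ^ e) ^ a₂ :=
          Real.rpow_le_rpow (by linarith only [hQk12]) hQk (by linarith only [ha₂])
      _ = d ^ (e * a₂) := by rw [← Real.rpow_mul hd0.le]
      _ ≤ x := hpowle hL2
  have hR3 : ThornerZaman.condQn N ^ a₆ ≤ x := by
    calc ThornerZaman.condQn N ^ a₆ ≤ (d ^ ((A : ℝ) + 10)) ^ a₆ :=
          Real.rpow_le_rpow (by linarith only [hQN12]) hQN (by linarith only [ha₆])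
      _ = d ^ ((A + 10) * a₆) := by rw [← Real.rpow_mul hd0.le]
      _ ≤ x := hpowle hL3
  have hR4 : X₀ ≤ x := by
    have h := mul_rpow_le_rpow_of_logb hd3 hX₀1
      (show (0 : ℝ) + Real.logb 3 X₀ ≤ L by linarith only [hL4])
    rwa [Real.rpow_zero, mul_one] at h
  have hx₀ : x₀ ≤ x := le_trans (le_max_left _ _) hR4
  have he16 : Real.exp 16 ≤ x := le_trans (le_max_right _ _) hR4
  have hx16 : 16 ≤ Real.log x := by
    have := Real.log_le_log (Real.exp_pos 16) he16
    rwa [Real.log_exp] at this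
  have hx1 : 1 < x := by linarith only [Real.add_one_le_exp (16 : ℝ), he16]
  have hR6 : (30 * A + 1) * d ≤ x := by
    have h := mul_rpow_le_rpow_of_logb hd3 (by linarith only [hA0] : (1 : ℝ) ≤ 30 * A + 1) hL6
    rwa [Real.rpow_one] at h
  have h38 : d ^ (3 / 8 * L) = x ^ (3 / 8 : ℝ) := by
    rw [hx, ← Real.rpow_mul hd0.le]; ring_nf
  have h58 : x ^ (3 / 8 : ℝ) * x ^ (5 / 8 : ℝ) = x := by
    rw [← Real.rpow_add hx0]; norm_num
  have hx38 : B₈ * d ^ (2 * e) ≤ x ^ (3 / 8 : ℝ) := by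
    rw [← h38]
    exact mul_rpow_le_rpow_of_logb hd3 hB₈1 (by linarith only [hL8])
  have hde1 : 1 ≤ d ^ (2 * e) := Real.one_le_rpow hd1 (by positivity)
  have hde0 : 0 < d ^ (2 * e) := by positivity
  have hx58 : 0 ≤ x ^ (5 / 8 : ℝ) := Real.rpow_nonneg hx0.le _
  have hR6b : 2 * 10 ^ 8 * x ^ (5 / 8 : ℝ) ≤ x := by
    have h1 : 2 * 10 ^ 8 ≤ x ^ (3 / 8 : ℝ) := by
      have h2 : 2 * 10 ^ 8 * 1 ≤ B₈ * d ^ (2 * e) := by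
        apply mul_le_mul _ hde1 zero_le_one (by linarith only [hB₈1])
        rw [hB₈]; linarith only [hB₈0]
      linarith only [h2, hx38]
    calc 2 * 10 ^ 8 * x ^ (5 / 8 : ℝ) ≤ x ^ (3 / 8 : ℝ) * x ^ (5 / 8 : ℝ) :=
          mul_le_mul_of_nonneg_right h1 hx58
      _ = x := h58
  have hR8a : (3 * 10 ^ 8 / c₁) * d ^ (2 * e) * x ^ (5 / 8 : ℝ) ≤ x := by
    have h1 : (3 * 10 ^ 8 / c₁) * d ^ (2 * e) ≤ x ^ (3 / 8 : ℝ) := by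
      have : (3 * 10 ^ 8 / c₁) * d ^ (2 * e) ≤ B₈ * d ^ (2 * e) :=
        mul_le_mul_of_nonneg_right (by rw [hB₈]; linarith only []) hde0.le
      linarith only [this, hx38]
    calc (3 * 10 ^ 8 / c₁) * d ^ (2 * e) * x ^ (5 / 8 : ℝ) ≤ x ^ (3 / 8 : ℝ) * x ^ (5 / 8 : ℝ) :=
          mul_le_mul_of_nonneg_right h1 hx58
      _ = x := h58
  have hR8b : B₉ * d ^ (2 * e + 1) ≤ x := mul_rpow_le_rpow_of_logb hd3 hB₉1 hL9
  -- the analytic inputs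
  have hθ : (1 - 1 / 20) * x ≤ Chebyshev.theta x := hθQ x hx₀
  have hθK' : degreeOneTheta K' x ≤ (1 + 1 / 20) * x :=
    (degreeOneTheta_le_chebyshevThetaIdeal K' x).trans (hup3 K' hK' x hR1)
  have hJ : chebyshevThetaIdeal k x - degreeOneTheta k x ≤ 2 * 10 ^ 7 * x ^ (5 / 8 : ℝ) :=
    quadratic_junk_le k hk hx1.le
  have hJx : 2 * 10 ^ 7 * x ^ (5 / 8 : ℝ) ≤ x / 10 := by linarith only [hR6b]
  have h3ℓ : 3 * Real.log ((NumberField.discr N).natAbs : ℝ) ≤ x / 10 := by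
    have e1 : (30 * A + 1) * d = 30 * (A * d) + d := by ring
    linarith only [hlogNd, hR6, e1, hd0]
  -- passing from a prime of `K'` to a prime of `K`
  have transfer : ∀ p : ℕ, p.Prime → ¬ ((p : ℤ) ∣ NumberField.discr N) → (splittingType K' p).count 1 = 0 →
      (Ideal.span {(p : 𝓞 K)}).IsPrime := by
    intro p hp hpN hcount
    have hcountK : (splittingType K p).count 1 = 0 := by
      rw [ArithmeticallyEquivalent.of_algEquiv eK p hp]; exact hcount
    have hdvd : ¬ ((p : ℤ) ∣ NumberField.discr K) := fun h =>
      hpN (h.trans (hdisc' ▸ NumberField.discr_dvd_discr K' N))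
    exact isPrime_span_of_count_one_eq_zero h3 hp hdvd hcountK
  -- EXIT F1: if `θ¹_k(x) ≥ 0.31 x − junk`, the `(ℚ, k, K)`-count wins
  have exitF1 : 31 / 100 * x - 2 * 10 ^ 7 * x ^ (5 / 8 : ℝ) ≤ degreeOneTheta k x →
      ∃ p : ℕ, p.Prime ∧ (p : ℝ) ≤ d ^ L ∧ (Ideal.span {(p : 𝓞 K)}).IsPrime := by
    intro hk_low
    have hsum := three_mul_inertSum_ge h6 hna K' k hK' hk x
    have hpos := inertSum_pos_F1 hsum hθ hk_low hθK' hJx h3ℓ hx0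
    obtain ⟨p, hp, hpx, hpN, hcount⟩ := exists_prime_of_sum_log_pos hpos
    exact ⟨p, hp, hpx, transfer p hp hpN hcount⟩
  -- the dichotomy for the quadratic resolvent
  rcases hrel2 k hk with hk1 | ⟨χ₁, β, hχreal, hβlo, hβ1, hLβ, hk2⟩
  · -- Case I: no exceptional zero for `k`
    apply exitF1
    have hlow := chebyshevThetaIdeal_ge_of_classBound k (η := 1 / 20) (x := x) (M := x)
      (fun C ↦ hk1 x hR2 C)
    linarith only [hlow, hJ, hx0]
  by_cases hχ1 : χ₁ = 1
  swap
  · -- Case I′: the exceptional character is non-trivial: the `β`-terms cancel over the classes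
    apply exitF1
    have hlow := chebyshevThetaIdeal_ge_of_classBound_char k (η := 1 / 20) hχ1 (fun C ↦ (hk2 x hR2 C).2)
    linarith only [hlow, hJ, hx0]
  -- Case II: `ζ_k(β) = 0`
  subst hχ1
  set M : ℝ := x - x ^ β / β with hM
  have hMC : ∀ C : ClassGroup (𝓞 k),
      x - (((1 : ClassGroup (𝓞 k) →* ℂˣ) C : ℂ)).re * x ^ β / β = M := by
    intro C; simp [hM]
  have hlow : (1 - 1 / 20) * M ≤ chebyshevThetaIdeal k x :=
    chebyshevThetaIdeal_ge_of_classBound k (η := 1 / 20) (x := x) (M := M) (fun C ↦ by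
      have := (hk2 x hR2 C).2; rwa [hMC] at this)
  by_cases hMx : x / 3 ≤ M
  · -- Case IIa: the main term is not small
    apply exitF1
    linarith only [hlow, hJ, hMx, hx0]
  -- Case IIb: the Landau–Siegel regime — go through `N`
  push Not at hMx
  have hβ34 : 3 / 4 ≤ β := by
    have hlog4 : 1 < Real.log 4 := by
      rw [show (4:ℝ) = 2 ^ 2 by norm_num, Real.log_pow]; have := Real.log_two_gt_d9; push_cast; linarith
    have hlogdk : 0 ≤ Real.log ((NumberField.discr k).natAbs : ℝ) := Real.log_natCast_nonneg _
    have hc4 : c₂ ≤ 1 / 4 := hc₂n.trans (by norm_num)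
    have : c₂ / (Real.log ((NumberField.discr k).natAbs : ℝ) + Real.log 4) ≤ 1 / 4 := by
      rw [div_le_iff₀ (by linarith only [hlogdk, hlog4])]; linarith only [hc4, hlogdk, hlog4]
    linarith only [hβlo, this]
  have hβ0 : 0 < β := by linarith only [hβ34]
  have hβne : (β : ℂ) ≠ 1 := by
    intro h; have := congrArg Complex.re h; simp at this; linarith only [this, hβ1]
  -- `β` is a real zero of `ζ_k`, hence of `ζ_N`
  have hζk : dedekindZeta₁ k β = 0 := by
    rw [dedekindZeta₁_apply_of_ne_one hβne, ← classGroupLFunction_one k hβne, hLβ, mul_zero]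
  have hζN : dedekindZeta₁ N β = 0 := dedekindZeta₁_eq_zero_of_resolvent N h6 hna K' k hK' hk hβ0 hβ1 hζk
  -- `β` is in the Landau–Page window of `N`
  have hlogreq : (Real.log ((NumberField.discr N).natAbs : ℝ) + Real.log 4) / c₆ ≤ Real.log x := by
    have hlog4 : Real.log 4 ≤ 2 * Real.log d := by
      rw [show (4:ℝ) = 2 ^ 2 by norm_num, Real.log_pow]; push_cast
      have h23 : Real.log 2 ≤ Real.log 3 := Real.log_le_log (by norm_num) (by norm_num)
      have h3d : Real.log 3 ≤ Real.log d := Real.log_le_log (by norm_num) hd3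
      linarith only [h23, h3d]
    rw [hlogx, div_le_iff₀ hc₆]
    have h1 : Real.log ((NumberField.discr N).natAbs : ℝ) + Real.log 4 ≤ (A + 2) * Real.log d := by
      linarith only [hlogN, hlog4]
    have hAL : (A + 2) ≤ L * c₆ := by rw [div_le_iff₀ hc₆] at hL7; exact hL7
    have h2 : (A + 2) * Real.log d ≤ L * c₆ * Real.log d := mul_le_mul_of_nonneg_right hAL hlogd0.le
    have e2 : L * c₆ * Real.log d = L * Real.log d * c₆ := by ring
    linarith only [h1, h2, e2]
  have hβwin := window_of_small_mainTerm hx1 hβ34 hβ1 hMx hlogN0 hc₆ hlogreq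
  -- the pointed relative prime number theorem for `N` at `β`
  obtain ⟨-, hNθ⟩ := hrel6 N h6 β hζN hβ0 hβ1 hβwin x hR3
  have hN1 : degreeOneTheta N x ≤ (1 + 1 / 20) * M := by
    have ha := (abs_le.mp hNθ).2
    have hb := degreeOneTheta_le_chebyshevThetaIdeal N x
    linarith only [ha, hb]
  -- the main term is `≫ x / Q_k²` (Stark)
  have hδ : c₁ * ThornerZaman.condQn k ^ (-(2 : ℝ)) ≤ 1 - β := heff k hk 1 hχreal β hβ1 hLβ
  have hQm2 : ThornerZaman.condQn k ^ (-(2 : ℝ)) ≤ 1 :=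
    Real.rpow_le_one_of_one_le_of_nonpos (by linarith only [hQk12]) (by norm_num)
  have hQm2' : 0 ≤ ThornerZaman.condQn k ^ (-(2 : ℝ)) := Real.rpow_nonneg (by linarith only [hQk12]) _
  have hMge : x / 4 * min 1 ((1 - β) * Real.log x) ≤ M := by
    have := sub_mul_rpow_div_ge (r := 1) hx1 hx16 hβ34 hβ1 (by norm_num)
    rwa [one_mul] at this
  have hMlow : x / 4 * (c₁ * ThornerZaman.condQn k ^ (-(2 : ℝ))) ≤ M :=
    mainTerm_ge_of_stark hx0.le hMge hδ hc₁1 hc₁.le hQm2 hQm2' (by linarith only [hx16])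
  have hQinv : (d ^ (2 * e))⁻¹ ≤ ThornerZaman.condQn k ^ (-(2 : ℝ)) := by
    rw [Real.rpow_neg (by linarith only [hQk12]), show (2 : ℝ) * e = e * 2 by ring, Real.rpow_mul hd0.le]
    exact inv_anti₀ (by positivity) (Real.rpow_le_rpow (by linarith only [hQk12]) hQk (by norm_num))
  set q : ℝ := x * c₁ / d ^ (2 * e) with hq
  have hq0 : 0 < q := by positivity
  have hqM : q / 4 ≤ M := by
    calc q / 4 = x / 4 * (c₁ * (d ^ (2 * e))⁻¹) := by rw [hq]; field_simp
      _ ≤ x / 4 * (c₁ * ThornerZaman.condQn k ^ (-(2 : ℝ))) :=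
          mul_le_mul_of_nonneg_left (mul_le_mul_of_nonneg_left hQinv hc₁.le) (by positivity)
      _ ≤ M := hMlow
  have hjunk1 : 3 * (2 * 10 ^ 7 * x ^ (5 / 8 : ℝ)) ≤ q / 5 := by
    rw [hq, div_div, le_div_iff₀ (by positivity)]
    have h1 := mul_le_mul_of_nonneg_right hR8a hc₁.le
    have e1 : (3 * 10 ^ 8 / c₁) * d ^ (2 * e) * x ^ (5 / 8 : ℝ) * c₁ =
        3 * 10 ^ 8 * (d ^ (2 * e) * x ^ (5 / 8 : ℝ)) := by field_simp
    rw [e1] at h1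
    have e2 : 3 * (2 * 10 ^ 7 * x ^ (5 / 8 : ℝ)) * (d ^ (2 * e) * 5) =
        3 * 10 ^ 8 * (d ^ (2 * e) * x ^ (5 / 8 : ℝ)) := by ring
    rw [e2]
    exact h1
  have hjunk2 : 6 * Real.log ((NumberField.discr N).natAbs : ℝ) ≤ q / 5 := by
    rw [hq, div_div, le_div_iff₀ (by positivity)]
    have h1 := mul_le_mul_of_nonneg_right hR8b hc₁.le
    have e1 : B₉ * d ^ (2 * e + 1) * c₁ = (30 * A + c₁) * (d ^ (2 * e) * d) := by
      rw [hB₉, Real.rpow_add hd0, Real.rpow_one]; field_simp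
    rw [e1] at h1
    have h2 := mul_le_mul_of_nonneg_right hlogNd hde0.le
    have h3 : 0 ≤ c₁ * (d ^ (2 * e) * d) := by positivity
    have e3 : (30 * A + c₁) * (d ^ (2 * e) * d) = 30 * (A * d * d ^ (2 * e)) + c₁ * (d ^ (2 * e) * d) := by
      ring
    have e4 : 6 * Real.log ((NumberField.discr N).natAbs : ℝ) * (d ^ (2 * e) * 5) =
        30 * (Real.log ((NumberField.discr N).natAbs : ℝ) * d ^ (2 * e)) := by ring
    rw [e4]
    linarith only [h1, h2, h3, e3]
  have hsum := six_mul_inertSum_ge h6 hna K' k hK' hk x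
  have hk_low : (1 - 1 / 20) * M - 2 * 10 ^ 7 * x ^ (5 / 8 : ℝ) ≤ degreeOneTheta k x := by
    linarith only [hlow, hJ]
  have hpos := inertSum_pos_F3 hsum hk_low hN1 hqM hjunk1 hjunk2 hq0
  obtain ⟨p, hp, hpx, hpN, hcount⟩ := exists_prime_of_sum_log_pos hpos
  exact ⟨p, hp, hpx, transfer p hp hpN hcount⟩

/-- **The least inert prime of a cubic field, unconditionally**: there is an absolute `L > 0` such that
every cubic number field `K` (Galois or not) has a rational prime `p ≤ |d_K|^{L}` with `p𝓞_K` a prime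
ideal.  GRH-free, Siegel-free, no hypothesis. [cite: LagariasMontgomeryOdlyzko1979, Theorem 1.1] -/
theorem exists_inertPrime_le :
    ∃ L : ℝ, 0 < L ∧ ∀ (K : Type) [Field K] [NumberField K], Module.finrank ℚ K = 3 →
      ∃ p : ℕ, p.Prime ∧ (p : ℝ) ≤ ((NumberField.discr K).natAbs : ℝ) ^ L ∧
        (Ideal.span {(p : 𝓞 K)}).IsPrime := by
  obtain ⟨L₁, hL₁, h₁⟩ := exists_inertPrime_le_of_not_isGalois
  obtain ⟨L₂, hL₂, h₂⟩ := exists_inertPrime_le_of_isGalois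
  refine ⟨max L₁ L₂, lt_max_of_lt_left hL₁, fun K _ _ h3 ↦ ?_⟩
  have hd1 : (1 : ℝ) ≤ ((NumberField.discr K).natAbs : ℝ) := by
    have h1 := Int.one_le_abs (NumberField.discr_ne_zero K)
    rw [Int.abs_eq_natAbs] at h1; exact_mod_cast h1
  by_cases hG : IsGalois ℚ K
  · obtain ⟨p, hp, hpx, hP⟩ := h₂ K h3
    exact ⟨p, hp, hpx.trans (Real.rpow_le_rpow_of_exponent_le hd1 (le_max_right _ _)), hP⟩
  · obtain ⟨p, hp, hpx, hP⟩ := h₁ K h3 hG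
    exact ⟨p, hp, hpx.trans (Real.rpow_le_rpow_of_exponent_le hd1 (le_max_left _ _)), hP⟩

end Summit.QuantumAdvantage.QuantumAdvantage.Theorems.DegreeOnePrimesEscape

end
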